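import Summits.QuantumFields.YangMills.Theorems.AlphaInputsT3ACv3StartShell
import Summits.QuantumFields.YangMills.Theorems.AlphaInputsT3ACv3StartRowsLine
import Summits.QuantumFields.YangMills.Theorems.AlphaInputsT3ACv3StartSystemBox
import HarnessLib

/-!
# `AlphaInputsT3ACv3StartStraddle` — START v3.1 for the (FL) `hLift` binder, row (S5)-4 knit: **THE STRADDLE ROWS `hTop`∕`hBot` OF ★w2 g2's `hbox_startSys`, AT BOTH USES** —
# (i) CONSTRAINED use (`InBall := BallBond · RbT`): a plaquette charted in a tube box at the top∕bottom slice (`u_λ = ±⌊L^k∕2⌋`) of an edge whose far∕near cells are in Ω is DEEP in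
# the vertex cube of that endpoint (`deep_of_top`, `deep_of_bot`); (ii) SHELL use: such a plaquette is NEVER a shell plaquette `ShellPlaq` (all its vertex-chart coordinates are
# `≤ RtT < RbT`), so the rows are vacuous there (`not_shellPlaq_of_top`, `not_shellPlaq_of_bot`) — via the chart identity `cornerSite k y μ ν = boxSite (vertexSite k y) (0,0,−h)` and
# the one-cell shift `vertexSite k (y − e_λ) = boxSite (vertexSite k y) (−L^k·e_λ)` — lane `pub-balaban3d` ∕ cell `ym3-torus`, seat `ym-ust-19936-w1` (g2, LEAD)

WHY (PROGRESS 8).  ★w2's `hbox_startSys` keeps `IsBall`∕`InBall` abstract and asks only the two straddle rows; THIS FILE discharges them for the canonical balls and shows them vacuous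
on the shell, so ONE lattice theorem serves `hbox` AND `hbox_sh` of `startT3_cert`.
WHAT IS HERE: §1 `cornerSite_eq_boxSite_vertexSite`, `natCast_val_sub_one_mul`, `vertexSite_unshift`, `shiftBy_unshift`; §2 `lam_ne`, `shiftBy_eq_cellOf`, `isInteriorVertex_of_top`∕
`_of_bot` (the 8 cells, with ★w2's `cellIn_cellOf`), `inBox_RbT_of_straddle`, `offsets01`; §3 ★`deep_of_top`, ★`deep_of_bot`; §4 `abs_lt_RbT_of_straddle`, ★`not_shellPlaq_of_top`, ★`not_shellPlaq_of_bot`.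
HONEST FRAMING.  Lattice bookkeeping (uses `hlam`: every direction is `μ`, `ν` or `λ` — d = 3 at T³); (FL)∕`hLift` NOT proved; count-neutral helper toward R3 2′ (items 19936∕19935);
registry untouched; nothing about d = 4, the continuum, or a mass gap; YM₃ on T³ is rung R3, not Clay.

References: T. Bałaban, Commun. Math. Phys. 109 (1987) 249–301 [Balaban1987RG1] ((0.1) p.251); Commun. Math. Phys. 102 (1985) 277–309 [Balaban1985Variational] ((11) p.279).
-/

set_option autoImplicit false

noncomputable section

namespace Summit.QuantumFields.YangMills.Theorems.TubeStart

open Literature.MathematicalPhysics.QuantumFieldTheory.Balaban1983to89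
open Literature.MathematicalPhysics.QuantumFieldTheory.Balaban1983to89.B10Eq38TorusDomains (toFine plaqsIn cornerSet mem_plaqsIn_iff)
open Summit.QuantumFields.Balaban3D.Carriers
open Summit.QuantumFields.YangMills.Theorems.ModelBox
open Summit.QuantumFields.YangMills.Theorems.Prop7FlatHolonomy (sitesPerDir_zero_eq_mul_pow)

variable {P : Params} {k : ℕ}

/-! ## §1 Chart identities -/

/-- **THE CORNER SITE IN THE VERTEX CHART**: `cornerSite k y μ ν = boxSite (vertexSite k y) (0 on μ,ν; −⌊L^k∕2⌋ elsewhere)`. [cite: Balaban1987RG1, (0.1) p.251] -/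
theorem cornerSite_eq_boxSite_vertexSite (y : Site P k) (μ ν : Fin P.d) :
    cornerSite k y μ ν = boxSite (vertexSite k y) (fun i => if i = μ ∨ i = ν then 0 else -((P.L ^ k / 2 : ℕ) : ℤ)) := by
  have hL : P.L ^ k = 2 * (P.L ^ k / 2) + 1 := pow_eq_two_mul_half_add_one k
  funext i
  simp only [cornerSite, boxSite, vertexSite_apply]
  set hh : ℕ := P.L ^ k / 2 with hhdef
  have hL1 : P.L ^ k - 1 = 2 * hh := by omega
  rw [hL1]
  split_ifs with h
  · push_cast; ring
  · push_cast; ring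

/-- Casting `(z − 1).val·L^k` down to the fine torus: `((z − 1).val·L^k : ZMod N₀) = z.val·L^k − L^k` (`N₀ = N_k·L^k`). [folklore] -/
theorem natCast_val_sub_one_mul (hk : k ≤ P.m + P.K) (z : ZMod (P.sitesPerDir k)) :
    ((((z - 1).val * P.L ^ k : ℕ)) : ZMod (P.sitesPerDir 0)) = (((z.val * P.L ^ k : ℕ)) : ZMod (P.sitesPerDir 0)) - ((P.L ^ k : ℕ) : ZMod (P.sitesPerDir 0)) := by
  have hN : P.sitesPerDir 0 = P.sitesPerDir k * P.L ^ k := sitesPerDir_zero_eq_mul_pow hk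
  -- `(z - 1).val ≡ z.val - 1 (mod N_k)`
  have h1 : ((((z - 1).val : ℕ) : ℤ) : ZMod (P.sitesPerDir k)) = (((z.val : ℤ) - 1 : ℤ) : ZMod (P.sitesPerDir k)) := by
    push_cast; rw [ZMod.natCast_zmod_val, ZMod.natCast_zmod_val]
  rw [ZMod.intCast_eq_intCast_iff_dvd_sub] at h1
  obtain ⟨c, hc⟩ := h1
  -- multiply by `L^k` and read in `ZMod N₀`
  have key : (((((z - 1).val : ℤ) * (P.L : ℤ) ^ k : ℤ)) : ZMod (P.sitesPerDir 0)) = ((((z.val : ℤ) - 1) * (P.L : ℤ) ^ k : ℤ) : ZMod (P.sitesPerDir 0)) := by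
    rw [ZMod.intCast_eq_intCast_iff_dvd_sub, hN]
    refine ⟨c, ?_⟩
    push_cast
    linear_combination ((P.L : ℤ) ^ k) * hc
  have h2 := key
  push_cast at h2 ⊢
  linear_combination h2

/-- **ONE CELL DOWN**: `boxSite (vertexSite k y) (−L^k·e_λ) = vertexSite k (y − e_λ)`. [cite: Balaban1987RG1, (0.1) p.251] -/
theorem vertexSite_unshift (hk : k ≤ P.m + P.K) (y : Site P k) (lam : Fin P.d) :
    boxSite (vertexSite k y) (fun i => if i = lam then -((P.L ^ k : ℕ) : ℤ) else 0) = vertexSite k (unshift y lam) := by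
  funext i
  simp only [boxSite, vertexSite_apply, unshift, Function.update_apply]
  split_ifs with h
  · subst h
    rw [Nat.cast_add, Nat.cast_add, natCast_val_sub_one_mul hk (y i)]
    push_cast; ring
  · simp

/-- Shifting a lowered site: `shiftBy (y − e_λ) f = (shiftBy y f) − e_λ`. [folklore] -/
theorem shiftBy_unshift (y : Site P k) (lam : Fin P.d) (f : Fin P.d → Bool) : shiftBy (unshift y lam) f = unshift (shiftBy y f) lam := by
  funext j
  simp only [shiftBy, unshift, Function.update_apply]
  by_cases h : j = lam
  · subst h; rw [if_pos rfl, if_pos rfl]; ring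
  · rw [if_neg h, if_neg h]

/-! ## §2 The eight cells and the straddle box -/

section Cells

variable (Ω : Set (Site P 0)) (Q : Plaq P k) (lam : Fin P.d) (hlam : ∀ j, ¬ (j = Q.μ ∨ j = Q.ν) ↔ j = lam)
include hlam

/-- `λ ∉ {μ, ν}`. [folklore] -/
theorem lam_ne : lam ≠ Q.μ ∧ lam ≠ Q.ν := by
  have := (hlam lam).mpr rfl
  exact ⟨fun h => this (Or.inl h), fun h => this (Or.inr h)⟩

/-- The cell `shiftBy y f` in terms of the quadrant cells: `shiftBy Q.src f = cellOf Q (!f μ, !f ν)`, shifted by `λ` iff `f λ`. [folklore] -/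
theorem shiftBy_eq_cellOf (f : Fin P.d → Bool) :
    shiftBy Q.src f = if f lam then (cellOf Q (!f Q.μ, !f Q.ν)).shift lam else cellOf Q (!f Q.μ, !f Q.ν) := by
  have hμν : Q.μ ≠ Q.ν := ne_of_lt Q.hμν
  obtain ⟨hlμ, hlν⟩ := lam_ne Q lam hlam
  funext j
  have hj : j = Q.μ ∨ j = Q.ν ∨ j = lam := by
    by_cases h : j = Q.μ ∨ j = Q.ν
    · rcases h with h | h
      · exact Or.inl h
      · exact Or.inr (Or.inl h)
    · exact Or.inr (Or.inr ((hlam j).mp h))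
  -- coordinate of the right-hand side
  have rhs : (if f lam then (cellOf Q (!f Q.μ, !f Q.ν)).shift lam else cellOf Q (!f Q.μ, !f Q.ν)) j =
      cellOf Q (!f Q.μ, !f Q.ν) j + (if j = lam ∧ f lam = true then 1 else 0) := by
    by_cases hf : f lam = true
    · rw [if_pos hf]
      by_cases hjl : j = lam
      · subst hjl; rw [if_pos ⟨rfl, hf⟩]; simp [Site.shift]
      · rw [if_neg (fun h => hjl h.1)]; simp [Site.shift, Function.update_of_ne hjl]
    · rw [if_neg hf, if_neg (fun h => hf h.2)]; simp
  rw [rhs, cellOf_apply]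
  simp only [shiftBy]
  rcases hj with rfl | rfl | rfl
  · simp only [true_and, hμν, false_and, if_false, add_zero, hlμ.symm]
    cases f Q.μ <;> simp
  · simp only [true_and, Ne.symm hμν, false_and, if_false, add_zero, hlν.symm]
    cases f Q.ν <;> simp
  · simp only [hlμ, hlν, false_and, if_false, add_zero, true_and]

open Classical in
/-- **THE FAR VERTEX IS INTERIOR**: the tube's four cells and the four cells ahead are all eight cells around `vertexSite k Q.src`. [folklore] -/
theorem isInteriorVertex_of_top (hQ : IsTubeΩ k Ω Q) (htop : ∀ s, CellIn Ω k ((cellOf Q s).shift lam)) : IsInteriorVertex k Ω Q.src := by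
  intro f
  rw [shiftBy_eq_cellOf Q lam hlam f]
  split_ifs
  · exact htop _
  · exact cellIn_cellOf hQ _

open Classical in
/-- **THE NEAR VERTEX IS INTERIOR**: the tube's four cells and the four cells behind are all eight cells around `vertexSite k (Q.src − e_λ)`. [folklore] -/
theorem isInteriorVertex_of_bot (hQ : IsTubeΩ k Ω Q) (hbot : ∀ s, CellIn Ω k (unshift (cellOf Q s) lam)) : IsInteriorVertex k Ω (unshift Q.src lam) := by
  intro f
  rw [shiftBy_unshift, shiftBy_eq_cellOf Q lam hlam f]
  split_ifs
  · rw [unshift_shift]; exact cellIn_cellOf hQ _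
  · exact hbot _

omit hlam in
/-- **THE STRADDLE BOX**: with `w := (0 on μ,ν; −h on λ)`, `|u_{μ,ν}| ≤ Rt`, `u_λ = h` and a 0∕1 offset `δ`, the vertex-chart point `w + u + δ` lies in the cube of half-side `RbT = Rt + 1`
(and strictly inside without the offset). [folklore] -/
theorem inBox_RbT_of_straddle (hlam' : ∀ j, ¬ (j = Q.μ ∨ j = Q.ν) → j = lam) {u δ : Fin P.d → ℤ} (hu : InTube Q.μ Q.ν (RtT P k) (P.L ^ k / 2) u)
    (hul : u lam = (P.L ^ k / 2 : ℕ)) (hδ : ∀ i, δ i = 0 ∨ δ i = 1) :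
    InBox (RbT P k) ((fun i => if i = Q.μ ∨ i = Q.ν then 0 else -((P.L ^ k / 2 : ℕ) : ℤ)) + u + δ) := by
  have hRR : (RtT P k : ℤ) + 1 = RbT P k := by exact_mod_cast RtT_succ P k
  intro i
  simp only [Pi.add_apply]
  by_cases hi : i = Q.μ ∨ i = Q.ν
  · rw [if_pos hi]
    have h1 := hu.abs_le_of_mem hi
    rw [abs_le] at h1 ⊢
    rcases hδ i with h | h <;> rw [h] <;> constructor <;> linarith
  · rw [if_neg hi, hlam' i hi, hul]
    have hR1 : (1 : ℤ) ≤ RbT P k := by have := RtT_succ P k; omega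
    rw [abs_le]
    rcases hδ lam with h | h <;> rw [h] <;> constructor <;> linarith

omit hlam in
/-- 0∕1 offsets: `0`, `e_α`, `e_β`, `e_α + e_β` (`α ≠ β`) for the corners of a plaquette. [folklore] -/
theorem offsets01 (q : Plaq P 0) :
    (∀ i, (0 : Fin P.d → ℤ) i = 0 ∨ (0 : Fin P.d → ℤ) i = 1) ∧ (∀ i, e q.μ i = 0 ∨ e q.μ i = 1) ∧ (∀ i, e q.ν i = 0 ∨ e q.ν i = 1) ∧
      (∀ i, (e q.μ + e q.ν) i = 0 ∨ (e q.μ + e q.ν) i = 1) := by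
  have hμν : q.μ ≠ q.ν := ne_of_lt q.hμν
  refine ⟨fun i => Or.inl rfl, fun i => ?_, fun i => ?_, fun i => ?_⟩
  · by_cases h : i = q.μ
    · subst h; exact Or.inr (e_apply_same _)
    · exact Or.inl (e_apply_ne h)
  · by_cases h : i = q.ν
    · subst h; exact Or.inr (e_apply_same _)
    · exact Or.inl (e_apply_ne h)
  · simp only [Pi.add_apply]
    by_cases h : i = q.μ
    · subst h; rw [e_apply_same, e_apply_ne hμν]; exact Or.inr (by ring)
    · by_cases h' : i = q.ν
      · subst h'; rw [e_apply_same, e_apply_ne (Ne.symm hμν)]; exact Or.inr (by ring)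
      · rw [e_apply_ne h, e_apply_ne h']; exact Or.inl (by ring)

end Cells

/-! ## §3 The straddle rows at the canonical balls -/

section Deep

variable (Ω : Set (Site P 0)) (Q : Plaq P k) (lam : Fin P.d) (hlam : ∀ j, ¬ (j = Q.μ ∨ j = Q.ν) ↔ j = lam)
include hlam

omit hlam in
/-- The four bonds of `q` are ball bonds of `v` once the vertex-chart corners `U + δ` are in the cube. [folklore] -/
theorem deep_of_corners {v : Site P 0} (hv : IsBallΩ k Ω v) (q : Plaq P 0) {U : Fin P.d → ℤ} (hsrc : q.src = boxSite v U)
    (B : ∀ δ : Fin P.d → ℤ, (∀ i, δ i = 0 ∨ δ i = 1) → InBox (RbT P k) (U + δ)) :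
    Plaq.Deep (IsBallΩ k Ω) (fun v b => BallBond v (RbT P k) b) q := by
  obtain ⟨h0, hμ, hν, hμν⟩ := offsets01 q
  have hB0 : InBox (RbT P k) U := by simpa using B 0 h0
  refine ⟨v, hv, fun b hb => ?_⟩
  rcases hb with rfl | rfl | rfl | rfl
  · exact ballBond_mk _ hB0 (B _ hμ) hsrc.symm
  · refine ballBond_mk _ (B _ hμ) (by rw [add_assoc]; exact B _ hμν) ?_
    rw [boxSite_add_e, ← hsrc]
  · refine ballBond_mk _ (B _ hν) (by rw [add_assoc, add_comm (e q.ν) (e q.μ)]; exact B _ hμν) ?_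
    rw [boxSite_add_e, ← hsrc]
  · exact ballBond_mk _ hB0 (B _ hν) hsrc.symm

/-- **★ `hTop` AT THE CANONICAL BALLS**: a plaquette charted in `Q`'s tube box at the top slice of an edge whose four cells ahead are in Ω is DEEP in the cube of half-side `RbT` around the
far vertex `vertexSite k Q.src`. [cite: Balaban1985Variational, (11) p.279] -/
theorem deep_of_top (hQ : IsTubeΩ k Ω Q) (htop : ∀ s, CellIn Ω k ((cellOf Q s).shift lam)) (q : Plaq P 0) {u : Fin P.d → ℤ}
    (hu : InTube Q.μ Q.ν (RtT P k) (P.L ^ k / 2) u) (hul : u lam = (P.L ^ k / 2 : ℕ)) (hsrc : q.src = boxSite (cornerSite k Q.src Q.μ Q.ν) u) :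
    Plaq.Deep (IsBallΩ k Ω) (fun v b => BallBond v (RbT P k) b) q := by
  have hlam' : ∀ j, ¬ (j = Q.μ ∨ j = Q.ν) → j = lam := fun j h => (hlam j).mp h
  have hsrc' : q.src = boxSite (vertexSite k Q.src) ((fun i => if i = Q.μ ∨ i = Q.ν then 0 else -((P.L ^ k / 2 : ℕ) : ℤ)) + u) := by
    rw [hsrc, cornerSite_eq_boxSite_vertexSite, boxSite_add]
  exact deep_of_corners Ω ⟨Q.src, isInteriorVertex_of_top Ω Q lam hlam hQ htop, rfl⟩ q hsrc' fun δ hδ => inBox_RbT_of_straddle Q lam hlam' hu hul hδ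

/-- The reflected chart point at the bottom slice: `u + L^k e_λ − e_λ` has `λ`-coordinate `h` and the same transverse coordinates. [folklore] -/
theorem reflect_bot {u : Fin P.d → ℤ} (hu : InTube Q.μ Q.ν (RtT P k) (P.L ^ k / 2) u) (hul : u lam = -((P.L ^ k / 2 : ℕ) : ℤ)) :
    InTube Q.μ Q.ν (RtT P k) (P.L ^ k / 2) (u + (fun i => if i = lam then ((P.L ^ k : ℕ) : ℤ) else 0) - e lam) ∧
      (u + (fun i => if i = lam then ((P.L ^ k : ℕ) : ℤ) else 0) - e lam) lam = (P.L ^ k / 2 : ℕ) := by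
  have hL : P.L ^ k = 2 * (P.L ^ k / 2) + 1 := pow_eq_two_mul_half_add_one k
  obtain ⟨hlμ, hlν⟩ := lam_ne Q lam hlam
  have hlam' : ∀ j, ¬ (j = Q.μ ∨ j = Q.ν) → j = lam := fun j h => (hlam j).mp h
  set hh : ℕ := P.L ^ k / 2 with hhdef
  have hval : (u + (fun i => if i = lam then ((P.L ^ k : ℕ) : ℤ) else 0) - e lam) lam = (hh : ℤ) := by
    show u lam + (if lam = lam then ((P.L ^ k : ℕ) : ℤ) else 0) - e lam lam = hh
    rw [if_pos rfl, e_apply_same, hul, hL]; push_cast; ring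
  refine ⟨fun i => ?_, hval⟩
  by_cases hi : i = Q.μ ∨ i = Q.ν
  · have hne : i ≠ lam := fun h => by subst h; rcases hi with h | h; exact hlμ h; exact hlν h
    rw [if_pos hi]
    have : (u + (fun i => if i = lam then ((P.L ^ k : ℕ) : ℤ) else 0) - e lam) i = u i := by
      simp only [Pi.add_apply, Pi.sub_apply, if_neg hne, e_apply_ne hne]; ring
    rw [this]; exact hu.abs_le_of_mem hi
  · rw [if_neg hi, hlam' i hi, hval]
    exact le_of_eq (abs_of_nonneg (by positivity))

omit hlam in
/-- The source of a bottom-slice plaquette in the chart of the near vertex. [folklore] -/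
theorem src_eq_of_bot (hk : k ≤ P.m + P.K) (q : Plaq P 0) {u : Fin P.d → ℤ} (hsrc : q.src.shift lam = boxSite (cornerSite k Q.src Q.μ Q.ν) u) :
    q.src = boxSite (vertexSite k (unshift Q.src lam))
      ((fun i => if i = Q.μ ∨ i = Q.ν then 0 else -((P.L ^ k / 2 : ℕ) : ℤ)) + (u + (fun i => if i = lam then ((P.L ^ k : ℕ) : ℤ) else 0) - e lam)) := by
  have h0 : q.src = boxSite (cornerSite k Q.src Q.μ Q.ν) (u - e lam) := (boxSite_sub_e_eq hsrc.symm).symm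
  rw [h0, cornerSite_eq_boxSite_vertexSite, ← boxSite_add, ← vertexSite_unshift hk Q.src lam, ← boxSite_add]
  congr 1
  funext i
  simp only [Pi.add_apply, Pi.sub_apply]
  split_ifs <;> ring

/-- **★ `hBot` AT THE CANONICAL BALLS**: a plaquette whose `λ`-shifted source is charted in `Q`'s tube box at the bottom slice, the four cells behind in Ω, is DEEP in the cube around the
near vertex `vertexSite k (Q.src − e_λ)`. [cite: Balaban1985Variational, (11) p.279] -/
theorem deep_of_bot (hk : k ≤ P.m + P.K) (hQ : IsTubeΩ k Ω Q) (hbot : ∀ s, CellIn Ω k (unshift (cellOf Q s) lam)) (q : Plaq P 0) {u : Fin P.d → ℤ}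
    (hu : InTube Q.μ Q.ν (RtT P k) (P.L ^ k / 2) u) (hul : u lam = -((P.L ^ k / 2 : ℕ) : ℤ)) (hsrc : q.src.shift lam = boxSite (cornerSite k Q.src Q.μ Q.ν) u) :
    Plaq.Deep (IsBallΩ k Ω) (fun v b => BallBond v (RbT P k) b) q := by
  have hlam' : ∀ j, ¬ (j = Q.μ ∨ j = Q.ν) → j = lam := fun j h => (hlam j).mp h
  obtain ⟨hu'T, hu'l⟩ := reflect_bot Q lam hlam hu hul
  exact deep_of_corners Ω ⟨unshift Q.src lam, isInteriorVertex_of_bot Ω Q lam hlam hQ hbot, rfl⟩ q (src_eq_of_bot Q lam hk q hsrc)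
    fun δ hδ => inBox_RbT_of_straddle Q lam hlam' hu'T hu'l hδ

end Deep

/-! ## §4 The straddle rows are vacuous on the shell -/

section Shell

variable (Ω : Set (Site P 0)) (Q : Plaq P k) (lam : Fin P.d) (hlam : ∀ j, ¬ (j = Q.μ ∨ j = Q.ν) ↔ j = lam)
include hlam

/-- In the straddle box (no offset) every vertex-chart coordinate is `< RbT`. [folklore] -/
theorem abs_lt_RbT_of_straddle {u : Fin P.d → ℤ} (hu : InTube Q.μ Q.ν (RtT P k) (P.L ^ k / 2) u) (hul : u lam = (P.L ^ k / 2 : ℕ)) (i : Fin P.d) :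
    |((fun i => if i = Q.μ ∨ i = Q.ν then 0 else -((P.L ^ k / 2 : ℕ) : ℤ)) + u) i| < RbT P k := by
  have hlam' : ∀ j, ¬ (j = Q.μ ∨ j = Q.ν) → j = lam := fun j h => (hlam j).mp h
  have hRR : (RtT P k : ℤ) + 1 = RbT P k := by exact_mod_cast RtT_succ P k
  simp only [Pi.add_apply]
  by_cases hi : i = Q.μ ∨ i = Q.ν
  · rw [if_pos hi, zero_add]; have := hu.abs_le_of_mem hi; linarith
  · rw [if_neg hi, hlam' i hi, hul]
    have hR1 : (1 : ℤ) ≤ RbT P k := by have := RtT_succ P k; omega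
    simp only [neg_add_cancel, abs_zero]
    linarith

omit hlam in
/-- A plaquette whose source has vertex-chart coordinates all `< RbT` (for some interior vertex `y`) is not a shell plaquette (`N₀ = N_k·L^k`, `2·RbT + 1 ≤ L^k`, `2·RbT + 1 ≤ N₀`).
[folklore] -/
theorem not_shellPlaq_of_lt (hNk : P.sitesPerDir 0 = P.sitesPerDir k * P.L ^ k) (hRL : 2 * RbT P k + 1 ≤ P.L ^ k) (hNb : 2 * RbT P k + 1 ≤ P.sitesPerDir 0)
    (q : Plaq P 0) {y : Site P k} {U : Fin P.d → ℤ} (hsrc : q.src = boxSite (vertexSite k y) U) (hlt : ∀ i, |U i| < RbT P k) : ¬ ShellPlaq k Ω q := by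
  rintro ⟨y', u', -, ⟨⟨hu'0, -, -, -⟩, i, -, -, hi⟩, hsrc'⟩
  have hU : InBox (RbT P k) U := fun j => (hlt j).le
  have hy : y = y' := eq_of_boxSite_vertexSite_eq hNk hRL hU hu'0 (hsrc.symm.trans hsrc')
  subst hy
  have hu' : U = u' := boxSite_injOn _ hNb hU hu'0 (hsrc.symm.trans hsrc')
  have := hlt i
  rw [hu', hi] at this
  exact lt_irrefl _ this

/-- **★ `hTop` IS VACUOUS ON THE SHELL**: a plaquette charted in a tube box at the top slice is not a shell plaquette of any interior vertex. [folklore] -/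
theorem not_shellPlaq_of_top (hNk : P.sitesPerDir 0 = P.sitesPerDir k * P.L ^ k) (hRL : 2 * RbT P k + 1 ≤ P.L ^ k) (hNb : 2 * RbT P k + 1 ≤ P.sitesPerDir 0)
    (q : Plaq P 0) {u : Fin P.d → ℤ} (hu : InTube Q.μ Q.ν (RtT P k) (P.L ^ k / 2) u) (hul : u lam = (P.L ^ k / 2 : ℕ))
    (hsrc : q.src = boxSite (cornerSite k Q.src Q.μ Q.ν) u) : ¬ ShellPlaq k Ω q := by
  have h1 : q.src = boxSite (vertexSite k Q.src) ((fun i => if i = Q.μ ∨ i = Q.ν then 0 else -((P.L ^ k / 2 : ℕ) : ℤ)) + u) := by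
    rw [hsrc, cornerSite_eq_boxSite_vertexSite, boxSite_add]
  exact not_shellPlaq_of_lt Ω hNk hRL hNb q h1 (abs_lt_RbT_of_straddle Q lam hlam hu hul)

/-- **★ `hBot` IS VACUOUS ON THE SHELL**: a plaquette whose `λ`-shifted source is charted at the bottom slice of a tube box is not a shell plaquette of any interior vertex. [folklore] -/
theorem not_shellPlaq_of_bot (hk : k ≤ P.m + P.K) (hNk : P.sitesPerDir 0 = P.sitesPerDir k * P.L ^ k) (hRL : 2 * RbT P k + 1 ≤ P.L ^ k)
    (hNb : 2 * RbT P k + 1 ≤ P.sitesPerDir 0) (q : Plaq P 0) {u : Fin P.d → ℤ} (hu : InTube Q.μ Q.ν (RtT P k) (P.L ^ k / 2) u)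
    (hul : u lam = -((P.L ^ k / 2 : ℕ) : ℤ)) (hsrc : q.src.shift lam = boxSite (cornerSite k Q.src Q.μ Q.ν) u) : ¬ ShellPlaq k Ω q := by
  obtain ⟨hu'T, hu'l⟩ := reflect_bot Q lam hlam hu hul
  exact not_shellPlaq_of_lt Ω hNk hRL hNb q (src_eq_of_bot Q lam hk q hsrc) (abs_lt_RbT_of_straddle Q lam hlam hu'T hu'l)

end Shell

end Summit.QuantumFields.YangMills.Theorems.TubeStart

end
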